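import Summits.BirchSwinnertonDyer.BirchSwinnertonDyer.Theorems.UniversalToricDescentThinCombFrameCovariance
import Literature.NumberTheory.EllipticCurves.ToricTwoVariablePAdicLFunctionUpTo
import Literature.NumberTheory.EllipticCurves.IntSeriesIdentityPrinciple
import HarnessLib

/-!
# Values of two-variable `R₀`-series under the group-like frame substitution `φ_A`, III: REFLECTION TRANSFER —
# `φ_A L = L` from equal values at `P_r` and at `σ·P_r` on a FIBRED supply of characters `r` through the pair
# (helper on the rational wall `RationalSplitIMCInclusionAtThree`, item stmt-BirchSwinnertonDyer-24207, line `ratwall_thin_comb` v8.2;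
# cell `pub/bsd-wall`, LEAD `cruxlead-24207` g32; `--supports stmt-BirchSwinnertonDyer-24207`)

WHY THIS FILE. Clause (ii) of the registered stub `stub_toricExistsSymmUpTo2` of the line asks that the ♯♯-frame `L₂` be symmetric up
to a unit under the PINNED frame involution `φ_{A_τ}` (`A_τ = frameMatrixOf κ₁ κ₂ γ₁ γ₂ τ`, `τ` a lift of `g ↦ c g⁻¹ c⁻¹`). Its status
in the census (v8.2 header, LEAD-CENSUS-g11) is «complex functional equation + density + unit bookkeeping — an ARGUMENT without a printed
statement». This file proves the ARGUMENT in the kernel, in values currency and for ANY map `σ : Γ_K → Γ_K` with frame matrix `A`: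

* §1 the FIBRED identity principle for `R₀⟦T₁⟧⟦T₂⟧` in the orientation of a `𝔭`-adapted frame (for infinitely many values `y` of the
  INNER variable, infinitely many OUTER values `x` — the fibres may depend on `y`; the tree's `IntSeries.eq_zero_of_infinite_zeros₂_fibred`
  is the other orientation, `UnrSeries.eq_zero_of_infinite_zeros₂` the product grid): `unr_eq_zero_of_infinite_zeros₂_innerFibred`,
  `unr_eq_of_infinite_hasValueAt₂_eq_innerFibred` (ported from the crux workfile `Cruxes/…/SketchSupplyGridG59.lean`, utd-idea g59, where
  the supply of such fibres in a `𝔭`-adapted frame is explained: characters of type `(2·3^e, 0)` kill `γ₂`);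
* §2 **`frameSubst_eq_self_of_reflectedValues`** — if on such a fibred supply of characters `r` through the pair the series `L` takes at
  `(r γ₁ − 1, r γ₂ − 1)` and at `(r(σγ₁) − 1, r(σγ₂) − 1)` the SAME value, then `φ_A L = L` (frame covariance Part II
  `hasValueAt₂_frameSubst_frameMatrixOf_iff`: `(φ_A L)(r γ₁ − 1, r γ₂ − 1) = L(r(σγ₁) − 1, r(σγ₂) − 1)`, then §1); in particular
  `Associated (φ_A L) L` (`associated_frameSubst_of_reflectedValues`) — the conclusion shape of clause (ii);
* §3 the toric reading **`frameSubst_eq_self_of_toricUpTo₂_of_reflectedDisplays`**: for a ♯♯-frame `L₂`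
  (`IsToricTwoVarLFunctionUpTo₂ C X Y …`) it suffices that the supply characters `ψ` (type `(a, −b)`, avatar `r`) come with PARTNERS `ψ′`
  of the reflected type `(b, −a)` whose avatars `r′` satisfy `r′(γ_j) = r(σ γ_j)` (for `σ = τ`: `ψ′ = ψ† = (ψ ∘ c)⁻¹`) and whose DISPLAYED
  values agree: `C·X^b·Y^a·ι⁻¹(V(ψ′)) = C·X^a·Y^b·ι⁻¹(V(ψ))`; and **`frameSubst_eq_self_of_toricUpTo₂_of_feRatio`**: the display agreement
  follows from a complex FUNCTIONAL EQUATION in display currency with a COMMON constant `κ ∈ ℂ`, `κ^a·V(ψ′) = κ^b·V(ψ)`, once the free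
  gradings are NORMALISED by `Y = X·ι⁻¹(κ)` (`display_eq_of_feRatio`). What is NOT proved here (the remaining inputs of clause (ii), each a
  printable statement): the supply (Weil existence of unramified characters of prescribed type + class-group twist + Jacquet continuation off
  the central ray), the partner dictionary `ψ† ↔ r ∘ τ`, and the complex functional equation of `L(f/K, ψ, s)` on the cone `Σ⁺` with its
  EXACT constant (LEAD-CENSUS-g32: root number `+1` on the cone under the Heegner hypothesis, `κ = N·D_K/4`).

Theorems only (no definition, no instance, no notation, no `sorry`); nothing about elliptic curves is proved; BSD is not proved by any of
this; 24207 stays OPEN.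

References: de Shalit II.4.17 (54), II.6.4 [cite: deShalit1987, II.4.17 (54), II.6.4 proof (p. 85)]; Gouvêa §5.6 Cor. 5.6.4
[cite: Gouvea1993PadicNumbers, §5.6 Cor. 5.6.4]; Castella–Wan §2.4 Thm. 2.11 [cite: CastellaWan2023, §2.4 Thm. 2.11 (arXiv:1607.02019)];
Hao–Loeffler §4 (the shape of the `p`-adic functional-equation argument) [cite: HaoLoeffler2025, §4 Thm. 4.9 (arXiv:2405.12611)];
Büyükboduk–Lei Def. 3.8 (the involution `τ`) [cite: BuyukbodukLei2017, Def. 3.8 (arXiv:1707.00557)]; Neukirch–Schmidt–Wingberg (5.3.5)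
[cite: NeukirchSchmidtWingberg2008, (5.3.5)].
-/

set_option linter.dupNamespace false
set_option autoImplicit false

noncomputable section

open scoped MatrixGroups
open Filter Topology Field
open Literature.NumberTheory.EllipticCurves Literature.NumberTheory.IwasawaTheory
open Literature.NumberTheory.GaloisRepresentations
open Literature.NumberTheory.EllipticCurves.IntSeries

namespace Summit.BirchSwinnertonDyer.BirchSwinnertonDyer.Theorems.UniversalToricDescentThinComb.ReflectionTransfer

open Summit.BirchSwinnertonDyer.Rank1Residual.X11b.Halves
open Summit.BirchSwinnertonDyer.BirchSwinnertonDyer.Theorems.UniversalToricDescentThinComb.FrameCovariance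

/-! ## §1 The fibred identity principle, inner-fibred orientation (ported from `Cruxes/…/SketchSupplyGridG59.lean`, utd-idea g59) -/

section Fibre

variable {p : ℕ} [Fact p.Prime]

/-- **Fibred identity principle, zeros form, `𝒪_{ℂ_p}⟦T₁⟧⟦T₂⟧`, INNER-fibred.** If for every `a` in an infinite set `D₂` of inner
values (`‖a‖ ≤ ‖ϖ‖ < 1`) the outer fibre `{x : ‖x‖ ≤ ‖ϖ‖, G(x, a) = 0}` is infinite, then `G = 0`. Proof: the line `T₂ = a` of `G` is
the line `T₁ = a` of `Gᵗ`; it vanishes (`lineSubst_eq_zero_of_infinite_zeros`), so every coefficient series `[T₁^k]G ∈ 𝒪⟦T₂⟧` has the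
infinitely many zeros `D₂`. (The tree's `eq_zero_of_infinite_zeros₂_fibred` is the OUTER-fibred orientation.)
[cite: Gouvea1993PadicNumbers, §5.6 Cor. 5.6.4] [cite: deShalit1987, II.6.4 proof (p. 85)] -/
theorem int_eq_zero_of_infinite_zeros₂_innerFibred {G : PowerSeries (PowerSeries (PadicComplexInt p))}
    {ϖ : ℂ_[p]} (hϖ0 : ϖ ≠ 0) (hϖ : ‖ϖ‖ < 1) {D₂ : Set (PadicComplexInt p)} (hD₂ : D₂.Infinite)
    (hD₂ϖ : ∀ a ∈ D₂, ‖(a : ℂ_[p])‖ ≤ ‖ϖ‖)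
    (h : ∀ a ∈ D₂, {x : ℂ_[p] | ‖x‖ ≤ ‖ϖ‖ ∧ IntSeries.HasValueAt₂ G x a 0}.Infinite) : G = 0 := by
  -- adapted from Cruxes/RationalSplitIMCInclusionAtThree/SketchSupplyGridG59.lean §1 (utd-idea g59)
  -- every line `T₂ = a`, `a ∈ D₂`, vanishes (as the line `T₁ = a` of the transpose)
  have hline : ∀ a ∈ D₂, lineSubst a (transpose G) = 0 := fun a ha ↦
    lineSubst_eq_zero_of_infinite_zeros (transpose G) ((hD₂ϖ a ha).trans_lt hϖ) hϖ0 hϖ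
      ((h a ha).mono fun x hx ↦ ⟨hx.1, (hasValueAt₂_transpose_iff G a x 0).mpr hx.2⟩)
  -- hence every coefficient series `[T₁^k] G` vanishes on `D₂`
  have hcoeff : ∀ k : ℕ, PowerSeries.coeff k G = 0 := by
    intro k
    refine eq_zero_of_infinite_zeros hϖ0 hϖ ((hD₂.image Subtype.coe_injective.injOn).mono ?_)
    rintro x ⟨a, ha, rfl⟩
    refine ⟨hD₂ϖ a ha, ?_⟩
    have hv := hasValueAt_coeff_transpose (transpose G) ((hD₂ϖ a ha).trans_lt hϖ) k
    rw [hline a ha, map_zero, transpose_transpose] at hv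
    simpa using hv
  exact PowerSeries.ext fun k ↦ by rw [hcoeff k, map_zero]

/-- **Fibred identity principle, zeros form, `R₀⟦T₁⟧⟦T₂⟧`, INNER-fibred** (inner values `y ∈ D₂ ⊆ ℂ_p` with `‖y‖ ≤ ‖ϖ‖`; transported
through `UnrSeries.toInt₂`). [cite: Gouvea1993PadicNumbers, §5.6 Cor. 5.6.4] [cite: deShalit1987, II.6.4 proof (p. 85)] -/
theorem unr_eq_zero_of_infinite_zeros₂_innerFibred {L : PowerSeries (UnrSeries p)} {ϖ : ℂ_[p]}
    (hϖ0 : ϖ ≠ 0) (hϖ : ‖ϖ‖ < 1) {D₂ : Set ℂ_[p]} (hD₂ : D₂.Infinite)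
    (hD₂ϖ : ∀ y ∈ D₂, ‖y‖ ≤ ‖ϖ‖)
    (h : ∀ y ∈ D₂, {x : ℂ_[p] | ‖x‖ ≤ ‖ϖ‖ ∧ UnrSeries.HasValueAt₂ L x y 0}.Infinite) : L = 0 := by
  -- adapted from Cruxes/RationalSplitIMCInclusionAtThree/SketchSupplyGridG59.lean §1 (utd-idea g59)
  apply UnrSeries.toInt₂_injective
  rw [map_zero]
  set D₂' : Set (PadicComplexInt p) := {c | (c : ℂ_[p]) ∈ D₂} with hD₂'
  have hD₂'inf : D₂'.Infinite := by
    intro hfin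
    apply hD₂
    refine (hfin.image (fun c : PadicComplexInt p ↦ (c : ℂ_[p]))).subset fun y hy ↦ ?_
    have hy1 : y ∈ PadicComplexInt p :=
      Literature.NumberTheory.EllipticCurves.mem_padicComplexInt_iff.mpr ((hD₂ϖ y hy).trans hϖ.le)
    exact ⟨⟨y, hy1⟩, hy, rfl⟩
  refine int_eq_zero_of_infinite_zeros₂_innerFibred hϖ0 hϖ hD₂'inf (fun c hc ↦ hD₂ϖ _ hc) fun c hc ↦
    (h _ hc).mono fun x hx ↦ ⟨hx.1, ?_⟩
  exact (UnrSeries.hasValueAt₂_iff_toInt₂ L _ _ _).mp hx.2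

/-- **Fibred identity principle, agreement form, `R₀⟦T₁⟧⟦T₂⟧`, INNER-fibred**: two series with a common value at every point of an
inner-fibred infinite set (infinitely many inner values `y` in a closed disc `‖y‖ ≤ ‖ϖ‖ < 1`, over each an infinite set of outer values
`x` in the disc, depending on `y`) are equal. [cite: Gouvea1993PadicNumbers, §5.6 Cor. 5.6.4] [cite: deShalit1987, II.6.4 proof (p. 85)] -/
theorem unr_eq_of_infinite_hasValueAt₂_eq_innerFibred {L L' : PowerSeries (UnrSeries p)} {ϖ : ℂ_[p]}
    (hϖ0 : ϖ ≠ 0) (hϖ : ‖ϖ‖ < 1) {D₂ : Set ℂ_[p]} (hD₂ : D₂.Infinite)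
    (hD₂ϖ : ∀ y ∈ D₂, ‖y‖ ≤ ‖ϖ‖)
    (h : ∀ y ∈ D₂, {x : ℂ_[p] | ‖x‖ ≤ ‖ϖ‖ ∧ ∃ v : ℂ_[p],
      UnrSeries.HasValueAt₂ L x y v ∧ UnrSeries.HasValueAt₂ L' x y v}.Infinite) : L = L' := by
  -- adapted from Cruxes/RationalSplitIMCInclusionAtThree/SketchSupplyGridG59.lean §1 (utd-idea g59)
  refine sub_eq_zero.mp (unr_eq_zero_of_infinite_zeros₂_innerFibred hϖ0 hϖ hD₂ hD₂ϖ fun y hy ↦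
    (h y hy).mono fun x hx ↦ ⟨hx.1, ?_⟩)
  obtain ⟨v, hv, hv'⟩ := hx.2
  simpa using hv.sub hv'

end Fibre

/-! ## §2 Reflection transfer: `φ_A L = L` from equal values at `P_r` and `σ·P_r` on a fibred supply -/

section Transfer

variable {p : ℕ} [Fact p.Prime] {K : Type} [Field K] [NumberField K]
  {κ₁ κ₂ : ZpExtension K p} {γ₁ γ₂ : absoluteGaloisGroup K}

/-- **REFLECTION TRANSFER (values form).** Let `(κ₁, κ₂; γ₁, γ₂)` be a generator pair of the `ℤ_p²`-tower, `σ : Γ_K → Γ_K` any map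
and `A = frameMatrixOf κ₁ κ₂ γ₁ γ₂ σ ∈ GL₂(ℤ_p)` (column `j` = coordinates of `σ γ_j`; e.g. `σ = τ`, a lift of `g ↦ c g⁻¹ c⁻¹`, and
`A = A_τ` the frame involution of the line). Suppose that `L ∈ R₀⟦T₁⟧⟦T₂⟧` takes, for the characters `r` through the pair of an
INNER-FIBRED supply (infinitely many inner values `r γ₂ − 1` in a closed disc `‖·‖ ≤ ‖ϖ‖ < 1`, over each infinitely many outer values
`r γ₁ − 1` in the disc), the SAME value at `(r γ₁ − 1, r γ₂ − 1)` and at the reflected point `(r(σγ₁) − 1, r(σγ₂) − 1)`. Then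
`φ_A L = L`. Proof: `(φ_A L)(r γ₁ − 1, r γ₂ − 1) = L(r(σγ₁) − 1, r(σγ₂) − 1)` (frame covariance, Part II) `= L(r γ₁ − 1, r γ₂ − 1)`,
and the fibred identity principle (§1). This is the «density» step of the `p`-adic functional-equation argument (Hao–Loeffler §4) in the
tree's currency. [cite: HaoLoeffler2025, §4 Thm. 4.9 (arXiv:2405.12611)] [cite: NeukirchSchmidtWingberg2008, (5.3.5)]
[cite: deShalit1987, II.6.4 proof (p. 85)] -/
theorem frameSubst_eq_self_of_reflectedValues (hpair : ZpExtension.IsTopGeneratorPair κ₁ κ₂ γ₁ γ₂)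
    (σ : absoluteGaloisGroup K → absoluteGaloisGroup K) (A : GL (Fin 2) ℤ_[p])
    (hA : (A : Matrix (Fin 2) (Fin 2) ℤ_[p]) = IwasawaAlgebra₂.frameMatrixOf κ₁ κ₂ γ₁ γ₂ σ)
    (L : PowerSeries (UnrSeries p)) {ϖ : ℂ_[p]} (hϖ0 : ϖ ≠ 0) (hϖ : ‖ϖ‖ < 1) {D₂ : Set ℂ_[p]}
    (hD₂ : D₂.Infinite) (hD₂ϖ : ∀ y ∈ D₂, ‖y‖ ≤ ‖ϖ‖)
    (h : ∀ y ∈ D₂, {x : ℂ_[p] | ‖x‖ ≤ ‖ϖ‖ ∧ ∃ (r : FramedGaloisRep K (PadicAlgCl p) 1) (v : ℂ_[p]),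
        FactorsThroughPair κ₁ κ₂ r ∧ avatarValueAt r γ₁ - 1 = x ∧ avatarValueAt r γ₂ - 1 = y ∧
        UnrSeries.HasValueAt₂ L x y v ∧
        UnrSeries.HasValueAt₂ L (avatarValueAt r (σ γ₁) - 1) (avatarValueAt r (σ γ₂) - 1) v}.Infinite) :
    letI : Algebra ℤ_[p] (unrIntegers p) := (toUnr p).toAlgebra
    IwasawaAlgebra₂.frameSubst (unrIntegers p) A L = L := by
  letI : Algebra ℤ_[p] (unrIntegers p) := (toUnr p).toAlgebra
  refine unr_eq_of_infinite_hasValueAt₂_eq_innerFibred hϖ0 hϖ hD₂ hD₂ϖ fun y hy ↦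
    (h y hy).mono fun x hx ↦ ⟨hx.1, ?_⟩
  obtain ⟨r, v, hr, hx1, hy1, hL, hLσ⟩ := hx.2
  refine ⟨v, ?_, hL⟩
  have hφ := (hasValueAt₂_frameSubst_frameMatrixOf_iff hpair hr σ A hA L v).mpr hLσ
  rwa [hx1, hy1] at hφ

/-- **Reflection transfer, `Associated` form** (the conclusion shape of clause (ii) of `stub_toricExistsSymmUpTo2`): under the hypotheses
of `frameSubst_eq_self_of_reflectedValues`, `φ_A L ∼ L`. [cite: HaoLoeffler2025, §4 Thm. 4.9 (arXiv:2405.12611)]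
[cite: BuyukbodukLei2017, Def. 3.8 (arXiv:1707.00557)] -/
theorem associated_frameSubst_of_reflectedValues (hpair : ZpExtension.IsTopGeneratorPair κ₁ κ₂ γ₁ γ₂)
    (σ : absoluteGaloisGroup K → absoluteGaloisGroup K) (A : GL (Fin 2) ℤ_[p])
    (hA : (A : Matrix (Fin 2) (Fin 2) ℤ_[p]) = IwasawaAlgebra₂.frameMatrixOf κ₁ κ₂ γ₁ γ₂ σ)
    (L : PowerSeries (UnrSeries p)) {ϖ : ℂ_[p]} (hϖ0 : ϖ ≠ 0) (hϖ : ‖ϖ‖ < 1) {D₂ : Set ℂ_[p]}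
    (hD₂ : D₂.Infinite) (hD₂ϖ : ∀ y ∈ D₂, ‖y‖ ≤ ‖ϖ‖)
    (h : ∀ y ∈ D₂, {x : ℂ_[p] | ‖x‖ ≤ ‖ϖ‖ ∧ ∃ (r : FramedGaloisRep K (PadicAlgCl p) 1) (v : ℂ_[p]),
        FactorsThroughPair κ₁ κ₂ r ∧ avatarValueAt r γ₁ - 1 = x ∧ avatarValueAt r γ₂ - 1 = y ∧
        UnrSeries.HasValueAt₂ L x y v ∧
        UnrSeries.HasValueAt₂ L (avatarValueAt r (σ γ₁) - 1) (avatarValueAt r (σ γ₂) - 1) v}.Infinite) :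
    letI : Algebra ℤ_[p] (unrIntegers p) := (toUnr p).toAlgebra
    Associated (IwasawaAlgebra₂.frameSubst (unrIntegers p) A L) L := by
  letI : Algebra ℤ_[p] (unrIntegers p) := (toUnr p).toAlgebra
  rw [frameSubst_eq_self_of_reflectedValues hpair σ A hA L hϖ0 hϖ hD₂ hD₂ϖ h]

end Transfer

/-! ## §3 The toric reading: partners of reflected type with agreeing displays -/

section Toric

variable {p : ℕ} [Fact p.Prime] {K : Type} [Field K] [NumberField K] {N : ℕ}
  {κ₁ κ₂ : ZpExtension K p} {γ₁ γ₂ : absoluteGaloisGroup K} {ι : PadicAlgCl p ≃+* ℂ}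
  {𝔭 𝔭' : IsDedekindDomain.HeightOneSpectrum (NumberField.RingOfIntegers K)}
  {f : CuspForm (CongruenceSubgroup.Gamma0 N) 2} {ΩK : ℂ} {C X Y : ℂ_[p]} {L₂ : PowerSeries (UnrSeries p)}

/-- **Display bookkeeping.** A complex relation `κ^a · V′ = κ^b · V` (a FUNCTIONAL EQUATION in display currency with constant `κ`) and
the NORMALISATION `Y = X · ι⁻¹(κ)` of the two free gradings give equal ♯♯-displays `C·X^b·Y^a·ι⁻¹(V′) = C·X^a·Y^b·ι⁻¹(V)`.
[cite: CastellaWan2023, §2.4 Thm. 2.11 (arXiv:1607.02019)] [cite: HaoLoeffler2025, §4 Thm. 4.9 (arXiv:2405.12611)] -/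
theorem display_eq_of_feRatio {κ V V' : ℂ} {a b : ℕ} (hfe : κ ^ a * V' = κ ^ b * V)
    (hY : Y = X * (((ι.symm κ : PadicAlgCl p)) : ℂ_[p])) :
    C * X ^ b * Y ^ a * (((ι.symm V' : PadicAlgCl p)) : ℂ_[p]) =
      C * X ^ a * Y ^ b * (((ι.symm V : PadicAlgCl p)) : ℂ_[p]) := by
  have h := congrArg (fun z : ℂ ↦ (((ι.symm z : PadicAlgCl p)) : ℂ_[p])) hfe
  simp only [map_mul, map_pow, PadicComplex.coe_eq] at h
  subst hY
  simp only [PadicComplex.coe_eq]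
  linear_combination C * X ^ a * X ^ b * h

/-- **REFLECTION TRANSFER for a ♯♯-frame, display form.** Let `L₂` be a ♯♯-frame (`IsToricTwoVarLFunctionUpTo₂ C X Y ι 𝔭 𝔭′ κ₁ κ₂ γ₁ γ₂
f Ω_K L₂`) in a generator pair, `σ : Γ_K → Γ_K`, `A = frameMatrixOf κ₁ κ₂ γ₁ γ₂ σ`. Suppose an INNER-FIBRED supply of interpolation data
`(ψ, a, b, r, L)` of the frame (unramified `ψ` of type `(a, −b)`, `a, b ≥ 1`, avatar `r` through the pair, entire continuation `L`) each of
which comes with a PARTNER datum `(ψ′, b, a, r′, L′)` of the REFLECTED type `(b, −a)` whose avatar sits at the reflected point,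
`r′(γ_j) = r(σ γ_j)` (for `σ = τ` a lift of `g ↦ c g⁻¹ c⁻¹`: `ψ′ = ψ† = (ψ ∘ c)⁻¹`), and whose DISPLAYED value agrees with that of `ψ`:
`C·X^b·Y^a·ι⁻¹(V(ψ′, b, a, L′(1))) = C·X^a·Y^b·ι⁻¹(V(ψ, a, b, L(1)))` (`V = toricInterpolationValue`). Then `φ_A L₂ = L₂`. Proof: the
frame prescribes `L₂(r γ₁ − 1, r γ₂ − 1)` and `L₂(r′ γ₁ − 1, r′ γ₂ − 1) = L₂(r(σγ₁) − 1, r(σγ₂) − 1)`; they agree; §2.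
[cite: CastellaWan2023, §2.4 Thm. 2.11 (arXiv:1607.02019)] [cite: HaoLoeffler2025, §4 Thm. 4.9 (arXiv:2405.12611)]
[cite: BuyukbodukLei2017, Def. 3.8 (arXiv:1707.00557)] -/
theorem frameSubst_eq_self_of_toricUpTo₂_of_reflectedDisplays
    (hpair : ZpExtension.IsTopGeneratorPair κ₁ κ₂ γ₁ γ₂)
    (σ : absoluteGaloisGroup K → absoluteGaloisGroup K) (A : GL (Fin 2) ℤ_[p])
    (hA : (A : Matrix (Fin 2) (Fin 2) ℤ_[p]) = IwasawaAlgebra₂.frameMatrixOf κ₁ κ₂ γ₁ γ₂ σ)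
    (hL : IsToricTwoVarLFunctionUpTo₂ C X Y ι 𝔭 𝔭' κ₁ κ₂ γ₁ γ₂ f ΩK L₂)
    {ϖ : ℂ_[p]} (hϖ0 : ϖ ≠ 0) (hϖ : ‖ϖ‖ < 1) {D₂ : Set ℂ_[p]} (hD₂ : D₂.Infinite)
    (hD₂ϖ : ∀ y ∈ D₂, ‖y‖ ≤ ‖ϖ‖)
    (h : ∀ y ∈ D₂, {x : ℂ_[p] | ‖x‖ ≤ ‖ϖ‖ ∧
      ∃ (ψ ψ' : HeckeCharacter K) (a b : ℕ) (r r' : FramedGaloisRep K (PadicAlgCl p) 1) (L L' : ℂ → ℂ),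
        1 ≤ a ∧ 1 ≤ b ∧ ψ.HasInfinityType (fun _ ↦ (a : ℤ)) (fun _ ↦ -(b : ℤ)) ∧
        (∀ w : IsDedekindDomain.HeightOneSpectrum (NumberField.RingOfIntegers K), ψ.IsUnramifiedAt w) ∧
        IsPAdicAvatarOf ι ψ r ∧ FactorsThroughPair κ₁ κ₂ r ∧ Differentiable ℂ L ∧
        (∀ s : ℂ, (a : ℝ) + 2 < s.re → L s = rankinSelbergEulerProductHecke f ψ s) ∧
        ψ'.HasInfinityType (fun _ ↦ (b : ℤ)) (fun _ ↦ -(a : ℤ)) ∧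
        (∀ w : IsDedekindDomain.HeightOneSpectrum (NumberField.RingOfIntegers K), ψ'.IsUnramifiedAt w) ∧
        IsPAdicAvatarOf ι ψ' r' ∧ FactorsThroughPair κ₁ κ₂ r' ∧ Differentiable ℂ L' ∧
        (∀ s : ℂ, (b : ℝ) + 2 < s.re → L' s = rankinSelbergEulerProductHecke f ψ' s) ∧
        avatarValueAt r' γ₁ = avatarValueAt r (σ γ₁) ∧ avatarValueAt r' γ₂ = avatarValueAt r (σ γ₂) ∧
        C * X ^ b * Y ^ a *
            ((((ι.symm (toricInterpolationValue p f 𝔭 𝔭' ψ' b a ΩK (L' 1))) : PadicAlgCl p) : ℂ_[p])) =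
          C * X ^ a * Y ^ b *
            ((((ι.symm (toricInterpolationValue p f 𝔭 𝔭' ψ a b ΩK (L 1))) : PadicAlgCl p) : ℂ_[p])) ∧
        avatarValueAt r γ₁ - 1 = x ∧ avatarValueAt r γ₂ - 1 = y}.Infinite) :
    letI : Algebra ℤ_[p] (unrIntegers p) := (toUnr p).toAlgebra
    IwasawaAlgebra₂.frameSubst (unrIntegers p) A L₂ = L₂ := by
  refine frameSubst_eq_self_of_reflectedValues hpair σ A hA L₂ hϖ0 hϖ hD₂ hD₂ϖ fun y hy ↦
    (h y hy).mono fun x hx ↦ ⟨hx.1, ?_⟩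
  obtain ⟨ψ, ψ', a, b, r, r', L, L', ha, hb, hinf, hunr, hr, hrκ, hLd, hLe, hinf', hunr', hr', hrκ', hLd',
    hLe', hσ₁, hσ₂, hdisp, hx1, hy1⟩ := hx.2
  have hv := hL.hasValueAt₂ ha hb hinf hunr hr hrκ hLd hLe
  rw [hx1, hy1] at hv
  have hv' := hL.hasValueAt₂ hb ha hinf' hunr' hr' hrκ' hLd' hLe'
  rw [hσ₁, hσ₂, hdisp] at hv'
  exact ⟨r, _, hrκ, hx1, hy1, hv, hv'⟩

/-- **REFLECTION TRANSFER for a ♯♯-frame from a complex FUNCTIONAL EQUATION with a common constant, after NORMALISING the gradings.**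
As `frameSubst_eq_self_of_toricUpTo₂_of_reflectedDisplays`, with the display agreement replaced by: ONE constant `κ ∈ ℂ` such that for
every supply datum and its partner `κ^a · V(ψ′, b, a, L′(1)) = κ^b · V(ψ, a, b, L(1))` (the complex functional equation
`Λ(f/K, ψ, 1) = ε · Λ(f/K, ψ†, 1)` read in display currency: `V(ψ†) = κ^{b−a} V(ψ)`; on the cone `Σ⁺` under the Heegner hypothesis the
root number is `+1` and `κ = N·D_K/4`, LEAD-CENSUS-g32), and the gradings of the frame normalised by `Y = X · ι⁻¹(κ)`. Then
`φ_A L₂ = L₂` — clause (ii) of `stub_toricExistsSymmUpTo2` ON THE NOSE for such a normalised frame. What this does NOT supply: the fibred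
partner supply itself (Weil + class-group twist + Jacquet; `ψ† ↔ r ∘ τ`) and the functional equation (print).
[cite: CastellaWan2023, §2.4 Thm. 2.11 (arXiv:1607.02019)] [cite: HaoLoeffler2025, §4 Thm. 4.9 (arXiv:2405.12611)]
[cite: BuyukbodukLei2017, Def. 3.8 (arXiv:1707.00557)] -/
theorem frameSubst_eq_self_of_toricUpTo₂_of_feRatio
    (hpair : ZpExtension.IsTopGeneratorPair κ₁ κ₂ γ₁ γ₂)
    (σ : absoluteGaloisGroup K → absoluteGaloisGroup K) (A : GL (Fin 2) ℤ_[p])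
    (hA : (A : Matrix (Fin 2) (Fin 2) ℤ_[p]) = IwasawaAlgebra₂.frameMatrixOf κ₁ κ₂ γ₁ γ₂ σ)
    (hL : IsToricTwoVarLFunctionUpTo₂ C X Y ι 𝔭 𝔭' κ₁ κ₂ γ₁ γ₂ f ΩK L₂)
    {κ : ℂ} (hY : Y = X * (((ι.symm κ : PadicAlgCl p)) : ℂ_[p]))
    {ϖ : ℂ_[p]} (hϖ0 : ϖ ≠ 0) (hϖ : ‖ϖ‖ < 1) {D₂ : Set ℂ_[p]} (hD₂ : D₂.Infinite)
    (hD₂ϖ : ∀ y ∈ D₂, ‖y‖ ≤ ‖ϖ‖)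
    (h : ∀ y ∈ D₂, {x : ℂ_[p] | ‖x‖ ≤ ‖ϖ‖ ∧
      ∃ (ψ ψ' : HeckeCharacter K) (a b : ℕ) (r r' : FramedGaloisRep K (PadicAlgCl p) 1) (L L' : ℂ → ℂ),
        1 ≤ a ∧ 1 ≤ b ∧ ψ.HasInfinityType (fun _ ↦ (a : ℤ)) (fun _ ↦ -(b : ℤ)) ∧
        (∀ w : IsDedekindDomain.HeightOneSpectrum (NumberField.RingOfIntegers K), ψ.IsUnramifiedAt w) ∧
        IsPAdicAvatarOf ι ψ r ∧ FactorsThroughPair κ₁ κ₂ r ∧ Differentiable ℂ L ∧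
        (∀ s : ℂ, (a : ℝ) + 2 < s.re → L s = rankinSelbergEulerProductHecke f ψ s) ∧
        ψ'.HasInfinityType (fun _ ↦ (b : ℤ)) (fun _ ↦ -(a : ℤ)) ∧
        (∀ w : IsDedekindDomain.HeightOneSpectrum (NumberField.RingOfIntegers K), ψ'.IsUnramifiedAt w) ∧
        IsPAdicAvatarOf ι ψ' r' ∧ FactorsThroughPair κ₁ κ₂ r' ∧ Differentiable ℂ L' ∧
        (∀ s : ℂ, (b : ℝ) + 2 < s.re → L' s = rankinSelbergEulerProductHecke f ψ' s) ∧
        avatarValueAt r' γ₁ = avatarValueAt r (σ γ₁) ∧ avatarValueAt r' γ₂ = avatarValueAt r (σ γ₂) ∧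
        κ ^ a * toricInterpolationValue p f 𝔭 𝔭' ψ' b a ΩK (L' 1) =
          κ ^ b * toricInterpolationValue p f 𝔭 𝔭' ψ a b ΩK (L 1) ∧
        avatarValueAt r γ₁ - 1 = x ∧ avatarValueAt r γ₂ - 1 = y}.Infinite) :
    letI : Algebra ℤ_[p] (unrIntegers p) := (toUnr p).toAlgebra
    IwasawaAlgebra₂.frameSubst (unrIntegers p) A L₂ = L₂ := by
  refine frameSubst_eq_self_of_toricUpTo₂_of_reflectedDisplays hpair σ A hA hL hϖ0 hϖ hD₂ hD₂ϖ fun y hy ↦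
    (h y hy).mono fun x hx ↦ ⟨hx.1, ?_⟩
  obtain ⟨ψ, ψ', a, b, r, r', L, L', ha, hb, hinf, hunr, hr, hrκ, hLd, hLe, hinf', hunr', hr', hrκ', hLd',
    hLe', hσ₁, hσ₂, hfe, hx1, hy1⟩ := hx.2
  exact ⟨ψ, ψ', a, b, r, r', L, L', ha, hb, hinf, hunr, hr, hrκ, hLd, hLe, hinf', hunr', hr', hrκ', hLd',
    hLe', hσ₁, hσ₂, display_eq_of_feRatio hfe hY, hx1, hy1⟩

/-- **`Associated` form of the normalised transfer** — literally the conclusion of clause (ii) of `stub_toricExistsSymmUpTo2` for the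
data `(C, X, Y = X·ι⁻¹(κ), L₂)`. [cite: HaoLoeffler2025, §4 Thm. 4.9 (arXiv:2405.12611)] [cite: BuyukbodukLei2017, Def. 3.8 (arXiv:1707.00557)] -/
theorem associated_frameSubst_of_toricUpTo₂_of_feRatio
    (hpair : ZpExtension.IsTopGeneratorPair κ₁ κ₂ γ₁ γ₂)
    (σ : absoluteGaloisGroup K → absoluteGaloisGroup K) (A : GL (Fin 2) ℤ_[p])
    (hA : (A : Matrix (Fin 2) (Fin 2) ℤ_[p]) = IwasawaAlgebra₂.frameMatrixOf κ₁ κ₂ γ₁ γ₂ σ)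
    (hL : IsToricTwoVarLFunctionUpTo₂ C X Y ι 𝔭 𝔭' κ₁ κ₂ γ₁ γ₂ f ΩK L₂)
    {κ : ℂ} (hY : Y = X * (((ι.symm κ : PadicAlgCl p)) : ℂ_[p]))
    {ϖ : ℂ_[p]} (hϖ0 : ϖ ≠ 0) (hϖ : ‖ϖ‖ < 1) {D₂ : Set ℂ_[p]} (hD₂ : D₂.Infinite)
    (hD₂ϖ : ∀ y ∈ D₂, ‖y‖ ≤ ‖ϖ‖)
    (h : ∀ y ∈ D₂, {x : ℂ_[p] | ‖x‖ ≤ ‖ϖ‖ ∧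
      ∃ (ψ ψ' : HeckeCharacter K) (a b : ℕ) (r r' : FramedGaloisRep K (PadicAlgCl p) 1) (L L' : ℂ → ℂ),
        1 ≤ a ∧ 1 ≤ b ∧ ψ.HasInfinityType (fun _ ↦ (a : ℤ)) (fun _ ↦ -(b : ℤ)) ∧
        (∀ w : IsDedekindDomain.HeightOneSpectrum (NumberField.RingOfIntegers K), ψ.IsUnramifiedAt w) ∧
        IsPAdicAvatarOf ι ψ r ∧ FactorsThroughPair κ₁ κ₂ r ∧ Differentiable ℂ L ∧
        (∀ s : ℂ, (a : ℝ) + 2 < s.re → L s = rankinSelbergEulerProductHecke f ψ s) ∧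
        ψ'.HasInfinityType (fun _ ↦ (b : ℤ)) (fun _ ↦ -(a : ℤ)) ∧
        (∀ w : IsDedekindDomain.HeightOneSpectrum (NumberField.RingOfIntegers K), ψ'.IsUnramifiedAt w) ∧
        IsPAdicAvatarOf ι ψ' r' ∧ FactorsThroughPair κ₁ κ₂ r' ∧ Differentiable ℂ L' ∧
        (∀ s : ℂ, (b : ℝ) + 2 < s.re → L' s = rankinSelbergEulerProductHecke f ψ' s) ∧
        avatarValueAt r' γ₁ = avatarValueAt r (σ γ₁) ∧ avatarValueAt r' γ₂ = avatarValueAt r (σ γ₂) ∧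
        κ ^ a * toricInterpolationValue p f 𝔭 𝔭' ψ' b a ΩK (L' 1) =
          κ ^ b * toricInterpolationValue p f 𝔭 𝔭' ψ a b ΩK (L 1) ∧
        avatarValueAt r γ₁ - 1 = x ∧ avatarValueAt r γ₂ - 1 = y}.Infinite) :
    letI : Algebra ℤ_[p] (unrIntegers p) := (toUnr p).toAlgebra
    Associated (IwasawaAlgebra₂.frameSubst (unrIntegers p) A L₂) L₂ := by
  letI : Algebra ℤ_[p] (unrIntegers p) := (toUnr p).toAlgebra
  rw [frameSubst_eq_self_of_toricUpTo₂_of_feRatio hpair σ A hA hL hY hϖ0 hϖ hD₂ hD₂ϖ h]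

end Toric

end Summit.BirchSwinnertonDyer.BirchSwinnertonDyer.Theorems.UniversalToricDescentThinComb.ReflectionTransfer

end
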